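import Summits.ResolutionOfSingularities.ResolutionOfSingularities.Theorems.DirectrixCutCells
import HarnessLib

/-! # ConeChainLetters — decomp-res-lens-4 g42 node «ConeChain», FILE A (§144: the CONE-FLAG LETTERS, stated BEFORE the law —
`ConeWitness I n y z` (g31's `PlaneConeAt` with the linear form exposed), the exceptional ideal `excIdealAt π x′ = 𝔪_x𝒪_{x′}`, the
flag ideal `flagIdealAt π J μ x′`, their tower forms `excIdeal T i` / `flagIdeal T n i`, and the letters (DF) `DirectrixFlagTower n T`
«every cone witness of `𝓘_{i+1,x_{i+1}}` lies in the flag ideal of the stage below» / (EC) `ExceptionalConeTower n T` «at some stage a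
generator of the exceptional ideal is a cone witness»).  VERBATIM slice of HOME/decomp-res-lens-4/g42/ConeChain.lean. -/


noncomputable section

open CategoryTheory AlgebraicGeometry IsLocalRing TopologicalSpace MvPolynomial
open Literature.AlgebraicGeometry.Resolution
open Summit.ResolutionOfSingularities.ResolutionOfSingularities.Theorems
open WeakOrderReduction ForcedTowerClasses DivergentTowerClasses MonomialTowerClasses
open HugDimensionClasses HugDimensionKernels SurfaceShadowClasses SurfaceShadowKernels
open NearPointCut (SingularClass)
open Scheme.IdealSheafData (vanishingIdeal)

universe u

namespace Summit.ResolutionOfSingularities.ResolutionOfSingularities.Theorems.HugValuationCut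

/-! ## ══ FILE A `Theorems/ConeChainLetters.lean` (§144; imports the LANDED `DirectrixCutCells`) ══ -/

section ConeLetters

/-! ## §144 (g42 · NEW · LETTERS) CONE WITNESSES, THE EXCEPTIONAL AND THE FLAG IDEAL, THE LETTERS (DF) / (EC) — stated BEFORE the
law, so that the independence batteries of `bc/Probe.lean` run without LAW B in scope -/

/-- **`ConeWitness I n y z` — `z` IS A CONE WITNESS of the marked stalk `𝓘_y` (weight `n`)**: `z ∈ 𝔪_y ∖ 𝔪_y²` and some
`f ∈ 𝓘_y` has `f − c·z^n ∈ 𝔪_y^{n+1}`, `c` a unit — the body of g31's `PlaneConeAt` with the linear form EXPOSED (the cone plane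
is `V(in z)`).  DEFINITION (support). -/
def ConeWitness {Y : Scheme.{u}} (I : Y.IdealSheafData) (n : ℕ) (y : Y) (z : Y.presheaf.stalk y) : Prop :=
  z ∈ maximalIdeal (Y.presheaf.stalk y) ∧ (z ∉ maximalIdeal (Y.presheaf.stalk y) ^ 2 ∧
    ∃ f ∈ stalkIdeal I y, ∃ c : Y.presheaf.stalk y, IsUnit c ∧ f - c * z ^ n ∈ maximalIdeal (Y.presheaf.stalk y) ^ (n + 1))

/-- `PlaneConeAt` (g31) is «some cone witness exists» (definitional). [folklore] -/
theorem planeConeAt_iff_exists_coneWitness {Y : Scheme.{0}} (I : Y.IdealSheafData) (n : ℕ) (y : Y) :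
    PlaneConeAt I n y ↔ ∃ z, ConeWitness I n y z := by
  simp only [PlaneConeAt, ConeWitness]

variable {X X' : Scheme.{u}}

/-- **The EXCEPTIONAL IDEAL at `x′`**: `𝔪_x·𝒪_{x′}` (the ideal of `E = π⁻¹(x)` at `x′`). DEFINITION (support). -/
def excIdealAt (π : X' ⟶ X) (x' : X') : Ideal (X'.presheaf.stalk x') :=
  (maximalIdeal (X.presheaf.stalk (π x'))).map (π.stalkMap x').hom

/-- **The FLAG IDEAL at `x′`** (weight `μ`): `𝔪_x 𝒪_{x′} + (w : u·w = φ y, y a cone witness of 𝓘_x, (u) = 𝔪_x 𝒪_{x′}) + 𝔪_{x′}²`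
— the conormal directions of the germ at `x′` of the CONE LINE `ℓ = ℙ(Dir_x) ⊂ E` (the `V(y/u, u)` of any cone witness `y`),
plus squares: `z ∈ flagIdealAt` says «the plane `V(in z) ⊂ T_{x′}` contains the tangent line `T_{x′} ℓ`».  DEFINITION (support). -/
def flagIdealAt (π : X' ⟶ X) (J : X.IdealSheafData) (μ : ℕ) (x' : X') : Ideal (X'.presheaf.stalk x') :=
  excIdealAt π x' ⊔
    Ideal.span {w | ∃ (y : X.presheaf.stalk (π x')) (u : X'.presheaf.stalk x'), ConeWitness J μ (π x') y ∧
      excIdealAt π x' = Ideal.span {u} ∧ (π.stalkMap x').hom y = u * w} ⊔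
    maximalIdeal (X'.presheaf.stalk x') ^ 2

/-- **`excIdeal T i` — THE EXCEPTIONAL IDEAL AT `x_{i+1}`**: `𝔪_{x_i}·𝒪_{x_{i+1}}`, the ideal of `E_i = π_i⁻¹(x_i)` at the next
marked point (principal: `E_i` is a Cartier divisor).  DEFINITION (support). -/
def excIdeal (T : ForcedTower) (i : ℕ) : Ideal ((T.St (i + 1)).presheaf.stalk (T.pt (i + 1))) :=
  excIdealAt (T.π i) (T.pt (i + 1))

/-- **`flagIdeal T n i` — THE FLAG IDEAL AT `x_{i+1}`** (weight `n`): exceptional ideal + the conormal directions `y/u` of the cone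
line germ `ℓ_i = ℙ(Dir_{x_i}) ⊂ E_i` through `x_{i+1}` + `𝔪_{x_{i+1}}²`.  DEFINITION (support). -/
def flagIdeal (T : ForcedTower) (n i : ℕ) : Ideal ((T.St (i + 1)).presheaf.stalk (T.pt (i + 1))) :=
  flagIdealAt (T.π i) (T.D i).ideal n (T.pt (i + 1))

/-- **LETTER (DF) «DIRECTRIX-FLAG TOWER»** (NEW, tower-intrinsic, weight `n`): at EVERY stage, EVERY cone witness `z` of the
marked stalk `𝓘_{i+1, x_{i+1}}` lies in the flag ideal of the stage below — the cone plane `V(in z) ⊂ T_{x_{i+1}}X_{i+1}` CONTAINS the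
tangent line of the cone line `ℓ_i ⊂ E_i` at `x_{i+1}`: the flag `x_{i+1} ∈ ℓ_i ⊂ (cone plane)` propagates along the whole tower. -/
def DirectrixFlagTower (n : ℕ) (T : ForcedTower) : Prop :=
  ∀ (i : ℕ) (z : (T.St (i + 1)).presheaf.stalk (T.pt (i + 1))), ConeWitness (T.D (i + 1)).ideal n (T.pt (i + 1)) z →
    z ∈ flagIdeal T n i

/-- **LETTER (EC) «EXCEPTIONAL-CONE STAGE»** (NEW, tower-intrinsic, weight `n`): at SOME stage the exceptional divisor IS the cone:
a generator `u` of `𝔪_{x_i}𝒪_{x_{i+1}}` is a cone witness of `𝓘_{i+1,x_{i+1}}` (`in_n 𝓘_{i+1} ∋ c̄·U^n`, the cone plane is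
`T_{x_{i+1}} E_i`). -/
def ExceptionalConeTower (n : ℕ) (T : ForcedTower) : Prop :=
  ∃ (i : ℕ) (u : (T.St (i + 1)).presheaf.stalk (T.pt (i + 1))), excIdeal T i = Ideal.span {u} ∧
    ConeWitness (T.D (i + 1)).ideal n (T.pt (i + 1)) u

/-- ¬(DF) unfolded: at some stage some cone witness escapes the flag ideal. [definitional] -/
theorem not_directrixFlagTower_iff {n : ℕ} {T : ForcedTower} :
    ¬ DirectrixFlagTower n T ↔ ∃ (i : ℕ) (z : (T.St (i + 1)).presheaf.stalk (T.pt (i + 1))),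
      ConeWitness (T.D (i + 1)).ideal n (T.pt (i + 1)) z ∧ z ∉ flagIdeal T n i := by
  simp only [DirectrixFlagTower, not_forall, exists_prop]

/-- ¬(EC) unfolded: no generator of any exceptional ideal is a cone witness. [definitional] -/
theorem not_exceptionalConeTower_iff {n : ℕ} {T : ForcedTower} :
    ¬ ExceptionalConeTower n T ↔ ∀ (i : ℕ) (u : (T.St (i + 1)).presheaf.stalk (T.pt (i + 1))),
      excIdeal T i = Ideal.span {u} → ¬ ConeWitness (T.D (i + 1)).ideal n (T.pt (i + 1)) u := by
  simp only [ExceptionalConeTower, not_exists, not_and]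

end ConeLetters

end Summit.ResolutionOfSingularities.ResolutionOfSingularities.Theorems.HugValuationCut
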